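import Literature.AnabelianGeometry.EtaleTheta.Discharge.Sec5TowerOfBiKummerFamilyConst
import Literature.AnabelianGeometry.EtaleTheta.Discharge.Sec5TowerOfBiKummerFamilyFacts
import Literature.AnabelianGeometry.EtaleTheta.Discharge.Sec5Thm57LevelOne
import Literature.AnabelianGeometry.EtaleTheta.Discharge.Sec5ModelCaseSlim

/-!
# [EtTh] §5, Theorem 5.7 at ALL levels for the ASSEMBLED tower `ofBiKummerFamily` (pp. 329–331 / PDF pp. 103–105)

Mochizuki, *The étale theta function …*, Publ. RIMS **45** (2009)
[cite: MochizukiEtTh2009, Thm 5.7 p.330 (PDF p.104); Rmk 4.3.2 p.318–319 (PDF pp.92–93)].  Seat abc-iut-L2-d4 (node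
`EtTh:Thm5.7`); PROOF-ONLY capstone over abc-iut-L2-t4's genuine tower (`FrobenioidThetaTowerOfBiKummerFamily.lean` p420398,
`Discharge/Sec5TowerOfBiKummerFamilyFacts.lean` p420698: the `Facts` bundle at every level) and this seat's
`Discharge/Sec5Thm57LevelOne.lean` (p418083: `thetaRootPreservedAll_of_constTorsion`), `…TowerOfBiKummerFamilyConst.lean`
(p421568: `hconst` for the assembled tower) and the model case `…ModelCaseSlim.lean` (p414333: every [FrdI] binder a theorem
of layer L1).

WHAT IT SAYS (`thetaRootPreservedAll_ofBiKummerFamily`): for the §5 tower ASSEMBLED from abc-iut-L2-t3's setting, a family of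
roots and a §2 tower (`𝔗 := ofBiKummerFamily …`) over a SLIM base of FSM-type with `Φ` non-dilating and `C` not of group-like
type ([EtTh] Thm. 3.7 (i)(ii), Rmk. 3.7.2) — abc-iut-L2-t4's `ThetaRootPreservedAll Ψ` (= Thm. 5.7 at the root level for EVERY
`N ≥ 1`, both halves of "`μ_{2l·N}(B_N) ∩ (O_K^×)^{1/N}`") holds MODULO EXACTLY: abc-iut-L2-t4's level-1 setting inputs
(`hσ`, `hH`, `hfrac`, `haut`, `hK₁` = Lemma 5.8's arithmetic step at level 1), Prop. 5.3 (vi) at every `A_N` (`hdiv`), the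
compatible descent of the identifications along the Rmk. 4.3.2 transitions (`hdesc`), the naturality of the constants along
`β_{1,N}` (`hnat`), the factorisation of the Galois action on `O^×(B_1)` through `G_K` (`hfac₁`, GAP G-L2d4-1), the
Thm. 4.4 (iv)/Prop. 2.4 transport data at level 1 (`hθ₁`), and the ONE anabelian residual `hc` — "the level-1 discrepancy
constant is a `2l`-th root of unity" (Cor. 2.8 (i) on the Kummer classes of Prop. 5.2 (iii) via Prop. 5.5/Thm. 5.6, and
Prop. 3.2 (iii)).  Every [FrdI] category-theoretic input (total epimorphicity, isotropy, Def. 1.3 (iii)(d), Thm. 3.4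
(ii)(iii)(v), Thm. 4.4 (i)'s `Ψ^bs`) is DISCHARGED by layer L1; the §5 defining relations, Prop. 4.3 (iii) and the
`(O_K^×)^{1/N}`-half are theorems.
HONEST FRAMING: a kernel-checked implication for data so constructed; nothing asserts that such data exist for an actual
curve, nor any result of [EtTh] unconditionally; typed ≠ discharged; no side taken on anything downstream. -/

noncomputable section

namespace Literature.AnabelianGeometry.EtaleTheta

open CategoryTheory Opposite Literature.AlgebraicGeometry.Frobenioids

universe u₀ v₀ u v w

namespace ThetaFrobenioidTower

variable {K : Type u₀} [Field K] {X : SemiGraphs.TemperedArithmeticGroup.{u₀} K} {D₀ : Type u₀} [Category.{v₀} D₀]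
  {V : FrdIMonoidStub.{w}} {T₀ : RealifiedDivisorMonoids (D₀ := D₀) V} {D : Type u} [Category.{v} D]
  {VD : FrdICatStub.{u, v, w} D} {S : BiKummerSetting X T₀ D VD}
  {pullFrac : ∀ {A A' : S.C} (_ : A' ⟶ A), S.biratUnits A → S.biratUnits A'}
  {lv : ℕ+} {E : Set ℕ+} {𝒯 : ThetaEnvTower.{max v w} E} {θ : S.biratUnits S.Aodot} {Bl : S.C}
  {Pl : S.FractionPair θ Bl} {Rl : S.NthRoot θ Pl lv pullFrac}
  (h : ModelFrobenioid.Hypotheses S.tf.divisorMonoid S.tf.ratFnFunctor)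
  (toB : ∀ A : S.C, S.biratUnits A →* S.tf.biratUnitsModel A) (Q : FrobenioidTheta.ThetaSubquotientStub.{w} D)
  (odd_l : Odd (lv : ℕ)) (R : ∀ N : ℕ+, S.NthRoot Rl.root Rl.pair N pullFrac) (ιX : 𝒯.PiX ≃ₜ* X.Pi)
  (hopen : ∀ N : ℕ+, IsOpen ((S.galoisSurj (R N).AN.base (R N).αData.isGalois).ker : Set X.Pi))
  (σ : ∀ N : ℕ+, Aut (R N).AN.base →* Aut (R N).AN)
  (K' : Type w) [Field K'] (constEmb : ∀ N : ℕ+, K'ˣ →* S.tf.biratUnitsModel (R N).BN)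
  (constEmb_injective : ∀ N : ℕ+, Function.Injective (constEmb N))
  (hdivc : ∀ (N : ℕ+) (g : Aut (R N).BN.base),
    ModelFrobenioid.div ((σ N ((BiKummerSetting.NthRoot.baseIso S (R N)).conjAut.symm g)).hom ≫ (R N).pair.num) =
      ModelFrobenioid.div (R N).pair.num)
  (hdivp : ∀ (N : ℕ+) (y : 𝒯.PiYdd),
    ModelFrobenioid.div ((σ N (S.galoisSurj (R N).AN.base (R N).αData.isGalois (ιX y.1))).hom ≫ (R N).pair.den) =
      ModelFrobenioid.div (R N).pair.den)
  (α : ∀ {N N' : ℕ+}, (N : ℕ) ∣ N' → ((R N').AN ⟶ (R N).AN))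
  (β : ∀ {N N' : ℕ+}, (N : ℕ) ∣ N' → ((R N').BN ⟶ (R N).BN))
  (comm_sCap : ∀ {N N' : ℕ+} (hd : (N : ℕ) ∣ N'), (R N').pair.num ≫ β hd = α hd ≫ (R N).pair.num)
  (comm_sCup : ∀ {N N' : ℕ+} (hd : (N : ℕ) ∣ N'), (R N').pair.den ≫ β hd = α hd ≫ (R N).pair.den)
  (isIsometry_α : ∀ {N N' : ℕ+} (hd : (N : ℕ) ∣ N'), (S.sec5Stub h).pre.IsIsometry (α hd))
  (degFr_α : ∀ {N N' : ℕ+} (hd : (N : ℕ) ∣ N'), ((S.sec5Stub h).pre.degFr (α hd) : ℕ) * N = N')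
  (isIsometry_β : ∀ {N N' : ℕ+} (hd : (N : ℕ) ∣ N'), (S.sec5Stub h).pre.IsIsometry (β hd))
  (degFr_β : ∀ {N N' : ℕ+} (hd : (N : ℕ) ∣ N'), ((S.sec5Stub h).pre.degFr (β hd) : ℕ) * N = N')
  (baseFrob_α : ∀ {N N' : ℕ+} (hd : (N : ℕ) ∣ N'), S.IsOfBaseFrobeniusType (α hd))
  (ρ_comm_β : ∀ {N N' : ℕ+} (hd : (N : ℕ) ∣ N'), ∃ x : 𝒯.PiX, ∀ g : 𝒯.PiX,
    (rhoFamily R ιX N' g).hom ≫ ModelFrobenioid.baseMap (β hd) =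
      ModelFrobenioid.baseMap (β hd) ≫ (rhoFamily R ιX N (x * g * x⁻¹)).hom)

  (hσ : ∀ (N : ℕ+) (g : Aut (R N).AN.base), ModelFrobenioid.baseMap (σ N g).hom = g.hom)
  (hH : ∀ y : 𝒯.PiX, y ∈ 𝒯.PiYdd → ιX y ∈ S.Hodot)
  (hfrac : ∀ {A B : S.C} (s' s'' : A ⟶ B) (h' : S.IsPreStep s') (h'' : S.IsPreStep s'')
    (hb : PreFrobenioid.BaseEquivalent S.F s' s''),
    (toB A (S.fracOf s' s'' h' h'' hb) : S.tf.ratFnFunctor.obj (op A.base)) * ModelFrobenioid.unit s'' =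
      ModelFrobenioid.unit s')
  (haut : ∀ {A : S.C} (e : Aut A) (x : S.biratUnits A),
    (toB A (S.biratAut A e x) : S.tf.ratFnFunctor.obj (op A.base)) =
      pull S.tf.ratFnFunctor (ModelFrobenioid.baseMap e.inv) (toB A x : S.tf.ratFnFunctor.obj (op A.base)))

include hσ hH hfrac haut in
/-- **[EtTh] Theorem 5.7 (root level) at ALL levels for the ASSEMBLED tower**, modulo exactly the inputs listed in the
module docstring (`hD`, `hslim`, `hnd`, `hN`; `hK₁`; `hdiv`; `hdesc`; `hnat`; `hfac₁`; `hθ₁`; `hc`).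
[cite: MochizukiEtTh2009, Thm 5.7 p.329–330 (PDF pp.103–104); Rmk 4.3.2 p.318–319 (PDF pp.92–93); Lem 5.8 p.331 (PDF p.105)] -/
theorem thetaRootPreservedAll_ofBiKummerFamily (hD : IsOfFSMType D) (hslim : IsSlim D)
    (hnd : IsNonDilatingOn S.tf.divisorMonoid)
    (hN : ∃ A : S.C, ¬ (PreFrobenioidData.ofModel S.tf.divisorMonoid S.tf.ratFnFunctor S.tf.divBNatTrans).IsGroupLikeObj A)
    (hK₁ : ((ofBiKummerFamily h toB Q odd_l R ιX hopen σ K' constEmb constEmb_injective hdivc hdivp α β comm_sCap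
      comm_sCup isIsometry_α degFr_α isIsometry_β degFr_β baseFrob_α ρ_comm_β).atLevel 1).ConstantsActByCyclotome)
    (Ψ : S.C ≌ S.C)
    (hdiv : ∀ (N : ℕ+) (α' : Ψ.functor.obj ((ofBiKummerFamily h toB Q odd_l R ιX hopen σ K' constEmb constEmb_injective hdivc hdivp α β comm_sCap
      comm_sCup isIsometry_α degFr_α isIsometry_β degFr_β baseFrob_α ρ_comm_β).AN N) ≅ (ofBiKummerFamily h toB Q odd_l R ιX hopen σ K' constEmb constEmb_injective hdivc hdivp α β comm_sCap
      comm_sCup isIsometry_α degFr_α isIsometry_β degFr_β baseFrob_α ρ_comm_β).AN N) (β' : Ψ.functor.obj ((ofBiKummerFamily h toB Q odd_l R ιX hopen σ K' constEmb constEmb_injective hdivc hdivp α β comm_sCap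
      comm_sCup isIsometry_α degFr_α isIsometry_β degFr_β baseFrob_α ρ_comm_β).BN N) ≅ (ofBiKummerFamily h toB Q odd_l R ιX hopen σ K' constEmb constEmb_injective hdivc hdivp α β comm_sCap
      comm_sCup isIsometry_α degFr_α isIsometry_β degFr_β baseFrob_α ρ_comm_β).BN N),
      ∃ e : (ofBiKummerFamily h toB Q odd_l R ιX hopen σ K' constEmb constEmb_injective hdivc hdivp α β comm_sCap
      comm_sCup isIsometry_α degFr_α isIsometry_β degFr_β baseFrob_α ρ_comm_β).AN N ≅ (ofBiKummerFamily h toB Q odd_l R ιX hopen σ K' constEmb constEmb_injective hdivc hdivp α β comm_sCap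
      comm_sCup isIsometry_α degFr_α isIsometry_β degFr_β baseFrob_α ρ_comm_β).AN N,
        (ofBiKummerFamily h toB Q odd_l R ιX hopen σ K' constEmb constEmb_injective hdivc hdivp α β comm_sCap
      comm_sCup isIsometry_α degFr_α isIsometry_β degFr_β baseFrob_α ρ_comm_β).pre.div (α'.inv ≫ Ψ.functor.map ((ofBiKummerFamily h toB Q odd_l R ιX hopen σ K' constEmb constEmb_injective hdivc hdivp α β comm_sCap
      comm_sCup isIsometry_α degFr_α isIsometry_β degFr_β baseFrob_α ρ_comm_β).sCap N) ≫ β'.hom) = (ofBiKummerFamily h toB Q odd_l R ιX hopen σ K' constEmb constEmb_injective hdivc hdivp α β comm_sCap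
      comm_sCup isIsometry_α degFr_α isIsometry_β degFr_β baseFrob_α ρ_comm_β).pre.div (e.hom ≫ (ofBiKummerFamily h toB Q odd_l R ιX hopen σ K' constEmb constEmb_injective hdivc hdivp α β comm_sCap
      comm_sCup isIsometry_α degFr_α isIsometry_β degFr_β baseFrob_α ρ_comm_β).sCap N) ∧
        (ofBiKummerFamily h toB Q odd_l R ιX hopen σ K' constEmb constEmb_injective hdivc hdivp α β comm_sCap
      comm_sCup isIsometry_α degFr_α isIsometry_β degFr_β baseFrob_α ρ_comm_β).pre.div (α'.inv ≫ Ψ.functor.map ((ofBiKummerFamily h toB Q odd_l R ιX hopen σ K' constEmb constEmb_injective hdivc hdivp α β comm_sCap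
      comm_sCup isIsometry_α degFr_α isIsometry_β degFr_β baseFrob_α ρ_comm_β).sCup N) ≫ β'.hom) = (ofBiKummerFamily h toB Q odd_l R ιX hopen σ K' constEmb constEmb_injective hdivc hdivp α β comm_sCap
      comm_sCup isIsometry_α degFr_α isIsometry_β degFr_β baseFrob_α ρ_comm_β).pre.div (e.hom ≫ (ofBiKummerFamily h toB Q odd_l R ιX hopen σ K' constEmb constEmb_injective hdivc hdivp α β comm_sCap
      comm_sCup isIsometry_α degFr_α isIsometry_β degFr_β baseFrob_α ρ_comm_β).sCup N))
    (hdesc : ∀ (N : ℕ+) (α' : Ψ.functor.obj ((ofBiKummerFamily h toB Q odd_l R ιX hopen σ K' constEmb constEmb_injective hdivc hdivp α β comm_sCap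
      comm_sCup isIsometry_α degFr_α isIsometry_β degFr_β baseFrob_α ρ_comm_β).AN N) ≅ (ofBiKummerFamily h toB Q odd_l R ιX hopen σ K' constEmb constEmb_injective hdivc hdivp α β comm_sCap
      comm_sCup isIsometry_α degFr_α isIsometry_β degFr_β baseFrob_α ρ_comm_β).AN N) (β' : Ψ.functor.obj ((ofBiKummerFamily h toB Q odd_l R ιX hopen σ K' constEmb constEmb_injective hdivc hdivp α β comm_sCap
      comm_sCup isIsometry_α degFr_α isIsometry_β degFr_β baseFrob_α ρ_comm_β).BN N) ≅ (ofBiKummerFamily h toB Q odd_l R ιX hopen σ K' constEmb constEmb_injective hdivc hdivp α β comm_sCap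
      comm_sCup isIsometry_α degFr_α isIsometry_β degFr_β baseFrob_α ρ_comm_β).BN N)
      (e : (ofBiKummerFamily h toB Q odd_l R ιX hopen σ K' constEmb constEmb_injective hdivc hdivp α β comm_sCap
      comm_sCup isIsometry_α degFr_α isIsometry_β degFr_β baseFrob_α ρ_comm_β).AN N ≅ (ofBiKummerFamily h toB Q odd_l R ιX hopen σ K' constEmb constEmb_injective hdivc hdivp α β comm_sCap
      comm_sCup isIsometry_α degFr_α isIsometry_β degFr_β baseFrob_α ρ_comm_β).AN N) (Dc Dp : Aut ((ofBiKummerFamily h toB Q odd_l R ιX hopen σ K' constEmb constEmb_injective hdivc hdivp α β comm_sCap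
      comm_sCup isIsometry_α degFr_α isIsometry_β degFr_β baseFrob_α ρ_comm_β).BN N)),
      α'.inv ≫ Ψ.functor.map ((ofBiKummerFamily h toB Q odd_l R ιX hopen σ K' constEmb constEmb_injective hdivc hdivp α β comm_sCap
      comm_sCup isIsometry_α degFr_α isIsometry_β degFr_β baseFrob_α ρ_comm_β).sCap N) ≫ β'.hom = e.hom ≫ (ofBiKummerFamily h toB Q odd_l R ιX hopen σ K' constEmb constEmb_injective hdivc hdivp α β comm_sCap
      comm_sCup isIsometry_α degFr_α isIsometry_β degFr_β baseFrob_α ρ_comm_β).sCap N ≫ Dc.hom →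
      α'.inv ≫ Ψ.functor.map ((ofBiKummerFamily h toB Q odd_l R ιX hopen σ K' constEmb constEmb_injective hdivc hdivp α β comm_sCap
      comm_sCup isIsometry_α degFr_α isIsometry_β degFr_β baseFrob_α ρ_comm_β).sCup N) ≫ β'.hom = e.hom ≫ (ofBiKummerFamily h toB Q odd_l R ιX hopen σ K' constEmb constEmb_injective hdivc hdivp α β comm_sCap
      comm_sCup isIsometry_α degFr_α isIsometry_β degFr_β baseFrob_α ρ_comm_β).sCup N ≫ Dp.hom →
      ∃ (α₁ : Ψ.functor.obj ((ofBiKummerFamily h toB Q odd_l R ιX hopen σ K' constEmb constEmb_injective hdivc hdivp α β comm_sCap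
      comm_sCup isIsometry_α degFr_α isIsometry_β degFr_β baseFrob_α ρ_comm_β).AN 1) ≅ (ofBiKummerFamily h toB Q odd_l R ιX hopen σ K' constEmb constEmb_injective hdivc hdivp α β comm_sCap
      comm_sCup isIsometry_α degFr_α isIsometry_β degFr_β baseFrob_α ρ_comm_β).AN 1) (β₁ : Ψ.functor.obj ((ofBiKummerFamily h toB Q odd_l R ιX hopen σ K' constEmb constEmb_injective hdivc hdivp α β comm_sCap
      comm_sCup isIsometry_α degFr_α isIsometry_β degFr_β baseFrob_α ρ_comm_β).BN 1) ≅ (ofBiKummerFamily h toB Q odd_l R ιX hopen σ K' constEmb constEmb_injective hdivc hdivp α β comm_sCap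
      comm_sCup isIsometry_α degFr_α isIsometry_β degFr_β baseFrob_α ρ_comm_β).BN 1)
        (e₁ : (ofBiKummerFamily h toB Q odd_l R ιX hopen σ K' constEmb constEmb_injective hdivc hdivp α β comm_sCap
      comm_sCup isIsometry_α degFr_α isIsometry_β degFr_β baseFrob_α ρ_comm_β).AN 1 ≅ (ofBiKummerFamily h toB Q odd_l R ιX hopen σ K' constEmb constEmb_injective hdivc hdivp α β comm_sCap
      comm_sCup isIsometry_α degFr_α isIsometry_β degFr_β baseFrob_α ρ_comm_β).AN 1),
        α'.inv ≫ Ψ.functor.map ((ofBiKummerFamily h toB Q odd_l R ιX hopen σ K' constEmb constEmb_injective hdivc hdivp α β comm_sCap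
      comm_sCup isIsometry_α degFr_α isIsometry_β degFr_β baseFrob_α ρ_comm_β).α (one_dvd_level N)) ≫ α₁.hom = (ofBiKummerFamily h toB Q odd_l R ιX hopen σ K' constEmb constEmb_injective hdivc hdivp α β comm_sCap
      comm_sCup isIsometry_α degFr_α isIsometry_β degFr_β baseFrob_α ρ_comm_β).α (one_dvd_level N) ∧
        β'.inv ≫ Ψ.functor.map ((ofBiKummerFamily h toB Q odd_l R ιX hopen σ K' constEmb constEmb_injective hdivc hdivp α β comm_sCap
      comm_sCup isIsometry_α degFr_α isIsometry_β degFr_β baseFrob_α ρ_comm_β).β (one_dvd_level N)) ≫ β₁.hom = (ofBiKummerFamily h toB Q odd_l R ιX hopen σ K' constEmb constEmb_injective hdivc hdivp α β comm_sCap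
      comm_sCup isIsometry_α degFr_α isIsometry_β degFr_β baseFrob_α ρ_comm_β).β (one_dvd_level N) ∧
        (ofBiKummerFamily h toB Q odd_l R ιX hopen σ K' constEmb constEmb_injective hdivc hdivp α β comm_sCap
      comm_sCup isIsometry_α degFr_α isIsometry_β degFr_β baseFrob_α ρ_comm_β).α (one_dvd_level N) ≫ e₁.hom = e.hom ≫ (ofBiKummerFamily h toB Q odd_l R ιX hopen σ K' constEmb constEmb_injective hdivc hdivp α β comm_sCap
      comm_sCup isIsometry_α degFr_α isIsometry_β degFr_β baseFrob_α ρ_comm_β).α (one_dvd_level N) ∧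
        (ofBiKummerFamily h toB Q odd_l R ιX hopen σ K' constEmb constEmb_injective hdivc hdivp α β comm_sCap
      comm_sCup isIsometry_α degFr_α isIsometry_β degFr_β baseFrob_α ρ_comm_β).pre.div (α₁.inv ≫ Ψ.functor.map ((ofBiKummerFamily h toB Q odd_l R ιX hopen σ K' constEmb constEmb_injective hdivc hdivp α β comm_sCap
      comm_sCup isIsometry_α degFr_α isIsometry_β degFr_β baseFrob_α ρ_comm_β).sCap 1) ≫ β₁.hom) = (ofBiKummerFamily h toB Q odd_l R ιX hopen σ K' constEmb constEmb_injective hdivc hdivp α β comm_sCap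
      comm_sCup isIsometry_α degFr_α isIsometry_β degFr_β baseFrob_α ρ_comm_β).pre.div (e₁.hom ≫ (ofBiKummerFamily h toB Q odd_l R ιX hopen σ K' constEmb constEmb_injective hdivc hdivp α β comm_sCap
      comm_sCup isIsometry_α degFr_α isIsometry_β degFr_β baseFrob_α ρ_comm_β).sCap 1) ∧
        (ofBiKummerFamily h toB Q odd_l R ιX hopen σ K' constEmb constEmb_injective hdivc hdivp α β comm_sCap
      comm_sCup isIsometry_α degFr_α isIsometry_β degFr_β baseFrob_α ρ_comm_β).pre.div (α₁.inv ≫ Ψ.functor.map ((ofBiKummerFamily h toB Q odd_l R ιX hopen σ K' constEmb constEmb_injective hdivc hdivp α β comm_sCap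
      comm_sCup isIsometry_α degFr_α isIsometry_β degFr_β baseFrob_α ρ_comm_β).sCup 1) ≫ β₁.hom) = (ofBiKummerFamily h toB Q odd_l R ιX hopen σ K' constEmb constEmb_injective hdivc hdivp α β comm_sCap
      comm_sCup isIsometry_α degFr_α isIsometry_β degFr_β baseFrob_α ρ_comm_β).pre.div (e₁.hom ≫ (ofBiKummerFamily h toB Q odd_l R ιX hopen σ K' constEmb constEmb_injective hdivc hdivp α β comm_sCap
      comm_sCup isIsometry_α degFr_α isIsometry_β degFr_β baseFrob_α ρ_comm_β).sCup 1))
    (hnat : ∀ (N : ℕ+) (c : K'ˣ),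
      (S.tf.ratFnFunctor.map (ModelFrobenioid.baseMap (β (one_dvd_level N))).op).hom
          ((constEmb 1 c : S.tf.biratUnitsModel (R 1).BN) : S.tf.ratFnFunctor.obj (op (R 1).BN.base)) =
        ((constEmb N c : S.tf.biratUnitsModel (R N).BN) : S.tf.ratFnFunctor.obj (op (R N).BN.base)))
    (hfac₁ : ∀ y ∈ ((ofBiKummerFamily h toB Q odd_l R ιX hopen σ K' constEmb constEmb_injective hdivc hdivp α β comm_sCap
      comm_sCup isIsometry_α degFr_α isIsometry_β degFr_β baseFrob_α ρ_comm_β).atLevel 1).imPiY, ∃ x ∈ ((ofBiKummerFamily h toB Q odd_l R ιX hopen σ K' constEmb constEmb_injective hdivc hdivp α β comm_sCap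
      comm_sCup isIsometry_α degFr_α isIsometry_β degFr_β baseFrob_α ρ_comm_β).atLevel 1).HB, ∀ u ∈ ((ofBiKummerFamily h toB Q odd_l R ιX hopen σ K' constEmb constEmb_injective hdivc hdivp α β comm_sCap
      comm_sCup isIsometry_α degFr_α isIsometry_β degFr_β baseFrob_α ρ_comm_β).atLevel 1).units ((ofBiKummerFamily h toB Q odd_l R ιX hopen σ K' constEmb constEmb_injective hdivc hdivp α β comm_sCap
      comm_sCup isIsometry_α degFr_α isIsometry_β degFr_β baseFrob_α ρ_comm_β).BN 1),
      (ofBiKummerFamily h toB Q odd_l R ιX hopen σ K' constEmb constEmb_injective hdivc hdivp α β comm_sCap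
      comm_sCup isIsometry_α degFr_α isIsometry_β degFr_β baseFrob_α ρ_comm_β).sgpCap 1 y * u * ((ofBiKummerFamily h toB Q odd_l R ιX hopen σ K' constEmb constEmb_injective hdivc hdivp α β comm_sCap
      comm_sCup isIsometry_α degFr_α isIsometry_β degFr_β baseFrob_α ρ_comm_β).sgpCap 1 y)⁻¹ = (ofBiKummerFamily h toB Q odd_l R ιX hopen σ K' constEmb constEmb_injective hdivc hdivp α β comm_sCap
      comm_sCup isIsometry_α degFr_α isIsometry_β degFr_β baseFrob_α ρ_comm_β).sgpCap 1 x * u * ((ofBiKummerFamily h toB Q odd_l R ιX hopen σ K' constEmb constEmb_injective hdivc hdivp α β comm_sCap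
      comm_sCup isIsometry_α degFr_α isIsometry_β degFr_β baseFrob_α ρ_comm_β).sgpCap 1 x)⁻¹)
    (hθ₁ : ∀ (α₁ : Ψ.functor.obj ((ofBiKummerFamily h toB Q odd_l R ιX hopen σ K' constEmb constEmb_injective hdivc hdivp α β comm_sCap
      comm_sCup isIsometry_α degFr_α isIsometry_β degFr_β baseFrob_α ρ_comm_β).AN 1) ≅ (ofBiKummerFamily h toB Q odd_l R ιX hopen σ K' constEmb constEmb_injective hdivc hdivp α β comm_sCap
      comm_sCup isIsometry_α degFr_α isIsometry_β degFr_β baseFrob_α ρ_comm_β).AN 1) (β₁ : Ψ.functor.obj ((ofBiKummerFamily h toB Q odd_l R ιX hopen σ K' constEmb constEmb_injective hdivc hdivp α β comm_sCap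
      comm_sCup isIsometry_α degFr_α isIsometry_β degFr_β baseFrob_α ρ_comm_β).BN 1) ≅ (ofBiKummerFamily h toB Q odd_l R ιX hopen σ K' constEmb constEmb_injective hdivc hdivp α β comm_sCap
      comm_sCup isIsometry_α degFr_α isIsometry_β degFr_β baseFrob_α ρ_comm_β).BN 1)
      (e₁ : (ofBiKummerFamily h toB Q odd_l R ιX hopen σ K' constEmb constEmb_injective hdivc hdivp α β comm_sCap
      comm_sCup isIsometry_α degFr_α isIsometry_β degFr_β baseFrob_α ρ_comm_β).AN 1 ≅ (ofBiKummerFamily h toB Q odd_l R ιX hopen σ K' constEmb constEmb_injective hdivc hdivp α β comm_sCap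
      comm_sCup isIsometry_α degFr_α isIsometry_β degFr_β baseFrob_α ρ_comm_β).AN 1) (Dc₁ Dp₁ : Aut ((ofBiKummerFamily h toB Q odd_l R ιX hopen σ K' constEmb constEmb_injective hdivc hdivp α β comm_sCap
      comm_sCup isIsometry_α degFr_α isIsometry_β degFr_β baseFrob_α ρ_comm_β).BN 1)),
      α₁.inv ≫ Ψ.functor.map ((ofBiKummerFamily h toB Q odd_l R ιX hopen σ K' constEmb constEmb_injective hdivc hdivp α β comm_sCap
      comm_sCup isIsometry_α degFr_α isIsometry_β degFr_β baseFrob_α ρ_comm_β).sCap 1) ≫ β₁.hom = e₁.hom ≫ (ofBiKummerFamily h toB Q odd_l R ιX hopen σ K' constEmb constEmb_injective hdivc hdivp α β comm_sCap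
      comm_sCup isIsometry_α degFr_α isIsometry_β degFr_β baseFrob_α ρ_comm_β).sCap 1 ≫ Dc₁.hom →
      α₁.inv ≫ Ψ.functor.map ((ofBiKummerFamily h toB Q odd_l R ιX hopen σ K' constEmb constEmb_injective hdivc hdivp α β comm_sCap
      comm_sCup isIsometry_α degFr_α isIsometry_β degFr_β baseFrob_α ρ_comm_β).sCup 1) ≫ β₁.hom = e₁.hom ≫ (ofBiKummerFamily h toB Q odd_l R ιX hopen σ K' constEmb constEmb_injective hdivc hdivp α β comm_sCap
      comm_sCup isIsometry_α degFr_α isIsometry_β degFr_β baseFrob_α ρ_comm_β).sCup 1 ≫ Dp₁.hom →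
      ∃ θ₁ : Aut ((ofBiKummerFamily h toB Q odd_l R ιX hopen σ K' constEmb constEmb_injective hdivc hdivp α β comm_sCap
      comm_sCup isIsometry_α degFr_α isIsometry_β degFr_β baseFrob_α ρ_comm_β).pre.base.obj ((ofBiKummerFamily h toB Q odd_l R ιX hopen σ K' constEmb constEmb_injective hdivc hdivp α β comm_sCap
      comm_sCup isIsometry_α degFr_α isIsometry_β degFr_β baseFrob_α ρ_comm_β).BN 1)) ≃* Aut ((ofBiKummerFamily h toB Q odd_l R ιX hopen σ K' constEmb constEmb_injective hdivc hdivp α β comm_sCap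
      comm_sCup isIsometry_α degFr_α isIsometry_β degFr_β baseFrob_α ρ_comm_β).pre.base.obj ((ofBiKummerFamily h toB Q odd_l R ιX hopen σ K' constEmb constEmb_injective hdivc hdivp α β comm_sCap
      comm_sCup isIsometry_α degFr_α isIsometry_β degFr_β baseFrob_α ρ_comm_β).BN 1)),
        ((ofBiKummerFamily h toB Q odd_l R ιX hopen σ K' constEmb constEmb_injective hdivc hdivp α β comm_sCap
      comm_sCup isIsometry_α degFr_α isIsometry_β degFr_β baseFrob_α ρ_comm_β).atLevel 1).StrvTransport Ψ α₁ e₁ θ₁ ∧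
        ((ofBiKummerFamily h toB Q odd_l R ιX hopen σ K' constEmb constEmb_injective hdivc hdivp α β comm_sCap
      comm_sCup isIsometry_α degFr_α isIsometry_β degFr_β baseFrob_α ρ_comm_β).atLevel 1).HB.map θ₁.toMonoidHom = ((ofBiKummerFamily h toB Q odd_l R ιX hopen σ K' constEmb constEmb_injective hdivc hdivp α β comm_sCap
      comm_sCup isIsometry_α degFr_α isIsometry_β degFr_β baseFrob_α ρ_comm_β).atLevel 1).HB)
    (hc : ∀ (α₁ : Ψ.functor.obj ((ofBiKummerFamily h toB Q odd_l R ιX hopen σ K' constEmb constEmb_injective hdivc hdivp α β comm_sCap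
      comm_sCup isIsometry_α degFr_α isIsometry_β degFr_β baseFrob_α ρ_comm_β).AN 1) ≅ (ofBiKummerFamily h toB Q odd_l R ιX hopen σ K' constEmb constEmb_injective hdivc hdivp α β comm_sCap
      comm_sCup isIsometry_α degFr_α isIsometry_β degFr_β baseFrob_α ρ_comm_β).AN 1) (β₁ : Ψ.functor.obj ((ofBiKummerFamily h toB Q odd_l R ιX hopen σ K' constEmb constEmb_injective hdivc hdivp α β comm_sCap
      comm_sCup isIsometry_α degFr_α isIsometry_β degFr_β baseFrob_α ρ_comm_β).BN 1) ≅ (ofBiKummerFamily h toB Q odd_l R ιX hopen σ K' constEmb constEmb_injective hdivc hdivp α β comm_sCap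
      comm_sCup isIsometry_α degFr_α isIsometry_β degFr_β baseFrob_α ρ_comm_β).BN 1)
      (e₁ : (ofBiKummerFamily h toB Q odd_l R ιX hopen σ K' constEmb constEmb_injective hdivc hdivp α β comm_sCap
      comm_sCup isIsometry_α degFr_α isIsometry_β degFr_β baseFrob_α ρ_comm_β).AN 1 ≅ (ofBiKummerFamily h toB Q odd_l R ιX hopen σ K' constEmb constEmb_injective hdivc hdivp α β comm_sCap
      comm_sCup isIsometry_α degFr_α isIsometry_β degFr_β baseFrob_α ρ_comm_β).AN 1) (Dc₁ Dp₁ : Aut ((ofBiKummerFamily h toB Q odd_l R ιX hopen σ K' constEmb constEmb_injective hdivc hdivp α β comm_sCap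
      comm_sCup isIsometry_α degFr_α isIsometry_β degFr_β baseFrob_α ρ_comm_β).BN 1)),
      α₁.inv ≫ Ψ.functor.map ((ofBiKummerFamily h toB Q odd_l R ιX hopen σ K' constEmb constEmb_injective hdivc hdivp α β comm_sCap
      comm_sCup isIsometry_α degFr_α isIsometry_β degFr_β baseFrob_α ρ_comm_β).sCap 1) ≫ β₁.hom = e₁.hom ≫ (ofBiKummerFamily h toB Q odd_l R ιX hopen σ K' constEmb constEmb_injective hdivc hdivp α β comm_sCap
      comm_sCup isIsometry_α degFr_α isIsometry_β degFr_β baseFrob_α ρ_comm_β).sCap 1 ≫ Dc₁.hom →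
      α₁.inv ≫ Ψ.functor.map ((ofBiKummerFamily h toB Q odd_l R ιX hopen σ K' constEmb constEmb_injective hdivc hdivp α β comm_sCap
      comm_sCup isIsometry_α degFr_α isIsometry_β degFr_β baseFrob_α ρ_comm_β).sCup 1) ≫ β₁.hom = e₁.hom ≫ (ofBiKummerFamily h toB Q odd_l R ιX hopen σ K' constEmb constEmb_injective hdivc hdivp α β comm_sCap
      comm_sCup isIsometry_α degFr_α isIsometry_β degFr_β baseFrob_α ρ_comm_β).sCup 1 ≫ Dp₁.hom →
      ∀ (hu₁ : Dc₁⁻¹ * Dp₁ ∈ ((ofBiKummerFamily h toB Q odd_l R ιX hopen σ K' constEmb constEmb_injective hdivc hdivp α β comm_sCap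
      comm_sCup isIsometry_α degFr_α isIsometry_β degFr_β baseFrob_α ρ_comm_β).atLevel 1).units ((ofBiKummerFamily h toB Q odd_l R ιX hopen σ K' constEmb constEmb_injective hdivc hdivp α β comm_sCap
      comm_sCup isIsometry_α degFr_α isIsometry_β degFr_β baseFrob_α ρ_comm_β).BN 1)) (c : (ofBiKummerFamily h toB Q odd_l R ιX hopen σ K' constEmb constEmb_injective hdivc hdivp α β comm_sCap
      comm_sCup isIsometry_α degFr_α isIsometry_β degFr_β baseFrob_α ρ_comm_β).Kˣ),
        ((ofBiKummerFamily h toB Q odd_l R ιX hopen σ K' constEmb constEmb_injective hdivc hdivp α β comm_sCap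
      comm_sCup isIsometry_α degFr_α isIsometry_β degFr_β baseFrob_α ρ_comm_β).atLevel 1).unitsToBirat ((ofBiKummerFamily h toB Q odd_l R ιX hopen σ K' constEmb constEmb_injective hdivc hdivp α β comm_sCap
      comm_sCup isIsometry_α degFr_α isIsometry_β degFr_β baseFrob_α ρ_comm_β).BN 1) ⟨Dc₁⁻¹ * Dp₁, hu₁⟩ = (ofBiKummerFamily h toB Q odd_l R ιX hopen σ K' constEmb constEmb_injective hdivc hdivp α β comm_sCap
      comm_sCup isIsometry_α degFr_α isIsometry_β degFr_β baseFrob_α ρ_comm_β).constEmb 1 c → c ^ (2 * (ofBiKummerFamily h toB Q odd_l R ιX hopen σ K' constEmb constEmb_injective hdivc hdivp α β comm_sCap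
      comm_sCup isIsometry_α degFr_α isIsometry_β degFr_β baseFrob_α ρ_comm_β).l) = 1) :
    (ofBiKummerFamily h toB Q odd_l R ιX hopen σ K' constEmb constEmb_injective hdivc hdivp α β comm_sCap
      comm_sCup isIsometry_α degFr_α isIsometry_β degFr_β baseFrob_α ρ_comm_β).ThetaRootPreservedAll Ψ := by
  have H₁ := facts_atLevel h toB Q odd_l R ιX hopen σ K' constEmb constEmb_injective hdivc hdivp hσ hH hfrac haut α β
    comm_sCap comm_sCup isIsometry_α degFr_α isIsometry_β degFr_β baseFrob_α ρ_comm_β 1 hK₁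
  obtain ⟨Ψbs, hΨbs, ⟨eΨ⟩⟩ := ThetaFrobenioid.exists_compatBase_of_model_slim (𝔉 := (ofBiKummerFamily h toB Q odd_l R ιX hopen σ K' constEmb constEmb_injective hdivc hdivp α β comm_sCap
      comm_sCup isIsometry_α degFr_α isIsometry_β degFr_β baseFrob_α ρ_comm_β).atLevel 1) Ψ rfl h hD hslim hnd hN
  haveI := hΨbs
  refine (ofBiKummerFamily h toB Q odd_l R ιX hopen σ K' constEmb constEmb_injective hdivc hdivp α β comm_sCap
      comm_sCup isIsometry_α degFr_α isIsometry_β degFr_β baseFrob_α ρ_comm_β).thetaRootPreservedAll_of_constTorsion Ψ (ThetaFrobenioid.epi_of_model (DivB := S.tf.divBNatTrans) h)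
    (ThetaFrobenioid.isOfIsotropicType_of_model (𝔉 := (ofBiKummerFamily h toB Q odd_l R ιX hopen σ K' constEmb constEmb_injective hdivc hdivp α β comm_sCap
      comm_sCup isIsometry_α degFr_α isIsometry_β degFr_β baseFrob_α ρ_comm_β).atLevel 1) rfl h.isGroupLike_rat)
    (ThetaFrobenioid.iiid_of_model (𝔉 := (ofBiKummerFamily h toB Q odd_l R ιX hopen σ K' constEmb constEmb_injective hdivc hdivp α β comm_sCap
      comm_sCup isIsometry_α degFr_α isIsometry_β degFr_β baseFrob_α ρ_comm_β).atLevel 1) rfl h.isGroupLike_rat)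
    (ThetaFrobenioid.preservesPreSteps_of_model (𝔉 := (ofBiKummerFamily h toB Q odd_l R ιX hopen σ K' constEmb constEmb_injective hdivc hdivp α β comm_sCap
      comm_sCup isIsometry_α degFr_α isIsometry_β degFr_β baseFrob_α ρ_comm_β).atLevel 1) rfl h hD Ψ)
    (ThetaFrobenioid.baseEquivalent_map_of_model (𝔉 := (ofBiKummerFamily h toB Q odd_l R ιX hopen σ K' constEmb constEmb_injective hdivc hdivp α β comm_sCap
      comm_sCup isIsometry_α degFr_α isIsometry_β degFr_β baseFrob_α ρ_comm_β).atLevel 1) rfl h hD hslim hnd hN Ψ) hdiv hdesc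
    (hconst_ofBiKummerFamily' h toB Q odd_l R ιX hopen σ K' constEmb constEmb_injective hdivc hdivp α β comm_sCap
      comm_sCup isIsometry_α degFr_α isIsometry_β degFr_β baseFrob_α ρ_comm_β hnat)
    H₁.sgpCapSpec H₁.sgpCupSpec H₁.biKummerDifferenceMem H₁.constantsActByCyclotome hfac₁
    (fun β₁ => ThetaFrobenioid.units_map_psiAut (𝔉 := (ofBiKummerFamily h toB Q odd_l R ιX hopen σ K' constEmb constEmb_injective hdivc hdivp α β comm_sCap
      comm_sCup isIsometry_α degFr_α isIsometry_β degFr_β baseFrob_α ρ_comm_β).atLevel 1) Ψ β₁ Ψbs eΨ) hθ₁ hc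

end ThetaFrobenioidTower

end Literature.AnabelianGeometry.EtaleTheta

end
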